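import Summits.QuantumFields.BalabanUV.Beta.FP.StepRecursionFeedNested
import Summits.QuantumFields.BalabanUV.Beta.CompositeOneShotJetData

/-!
# `BalabanUV.Beta.FP.StepRecursionFeedNestedComp` — road «FP» for binder row D1: **THE ROAD's END AT THE RECORD PAIR `(Js, Jc) = (JsB12CombShSym …, JcComp …)`
# IN THE NESTED CURRENCY — `hN` DISCHARGED BY NAME** (an2's F6D SPEC FINAL S-an2-g54-1 §2 ∕ §3; the OWNER's R-FP-66 criterion «the literal's objects NAMED ONCE»;
# #42b `StepRecursionFeedNested` §1 ∕ §3 + an2 F6d-2 `CompositeOneShotJetData.hN_JcComp ∕ JcComp_one`)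

WHAT.  #42b §3 `d1Tel_anchored_of_hessKer_laws_anchored_wStep` reads the one-shot identification `hN` at EVERY storey `j ≥ 0`; under (D-b) the storey-`0` member is NOT by
construction (it is the depth-1 chart ∕ table ∕ pin identity (H-1)(H-2)(H-3) — the ROW's items, F6D SPEC FINAL §3), whereas for `j ≥ 1` an2's F6d-2 supplies
`hN_JcComp` BY NAME (`TOf_pullJ` read backwards).  This file composes the NESTED currency at the pair: `hlaw (j ≥ 1)` (the road's `TowerKernelLawNamed` per storey,
R-FP-72), the ANCHOR storey's fine identification `hF₁` (the row's (H-1)(H-2)(H-3) content), the TRANSPORT clause `htr (j ≥ 1)` (#42b §2 from leaf-02's TRANSPORT′ +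
nested namings + units + TAD), `hG (j ≥ 1)` (the row's (F2) chart identity + table bookkeeping), (T0)(T1) (an1 ∕ an3's Ward letters) — DISPLAYED — and `hN (j ≥ 1) :=
hN_JcComp`, `hJc1 := JcComp_one` — DISCHARGED ⟹ `D1Tel Lc (JsB12CombShSym hLc N (symTablesAn1S2 3 Lc cΛ) cΛ cB) (JcComp hLc N cΛ cB R P)` = ROOT M‴'s `htel` binder
read at the record pair; `_ctr` = the (β1) tower's instance `R := Roots.ctr Lc`.  Proof: #28 §5 `d1Tel_anchored_of_kernel_laws_wStep` with `hF 1 := hF₁` and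
`hF (j+2) := fineId_of_transport_of_oneShotId … (hN_JcComp (j+1)) (htr (j+1))` (#42b §1).  The N-system IS an2's `(AN R j, VN R P j, WN R P j)` (F6d-2 §3's
definitions) — no other N-system can carry `hN` by name.  [folklore] ONE composition BY NAME; no `def`, no `def … : Prop`, nothing cited, 0 sorry.  Every displayed
row is a HYPOTHESIS; nothing of the dictionary ∕ Bałaban's asserted, valued or discharged (the pair is the ROW's F6D SPEC FINAL; the presentation its (β1)∕(D-b)∕(A)
rulings, quoted).  CONSUMERS: `Gaps/D1BinderEnds`-class readers of M‴'s `htel` (the binder `D1Tel`); BF-x's `d1Rep_BFx_hyb_sbpS` takes the same pair (its `hC₁` +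
(J1-COMP) are the row's ∕ road «BF-x»'s).  No existing file touched.

HONEST DEPENDENCY (page 1, mandatory): continuum YM on T⁴ ⇐ BetaPertH ∧ nine spine estimates (0/9 proved); BetaPertH ⇐ (D1) ∧ (D4) ∧ CAP+tail;
G-an2-4 gates asym, D1 and NE2/3/4.  HONEST FRAMING (cell contract, verbatim): «discharging `BetaPertH` makes Bałaban's UV stability UNCONDITIONAL —
a real constructive-QFT result; it is NOT the continuum limit and NOT the Clay problem.»  ABSOLUTE RULE (cell charter, verbatim): «No internally-minted
statement may enter as a cited fact. Every hypothesis is either kernel-proved in this package or a verbatim quotation of a PUBLISHED theorem with page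
reference. The manuscript(s) under audit are NOT citable for their own disputed steps — they are the thing under adjudication; programme-internal
(2001/route/tribunal) claims are never citable.»  0 estimates; 0∕4 row-D1 binders (hW, hR, D1Tel, D1Rep — `D1Tel` CONCLUDED here only from displayed rows);
ROOT M‴ p325680 untouched; NOT (C1), NOT (L2′) beyond `hN`'s name, NOT (T-ID), NOT SDF, NOT D1, NOT BetaPertH, NOT continuum, NOT Clay.  Road «FP» OWNER,
b2b-balaban-beta-d1-p3 gen 31, 2026-08-24.  No existing file touched.
-/

noncomputable section

namespace Summit.QuantumFields.BalabanUV.Beta.FP.StepRecursionFeedNestedComp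

open Literature.MathematicalPhysics.QuantumFieldTheory
open Literature.MathematicalPhysics.QuantumFieldTheory.Balaban1983to89
open Literature.MathematicalPhysics.QuantumFieldTheory.Balaban1983to89.Beta
open DressedMomentNormalisation (EKer dressedEntry)
open ExpKernelCalculus (MKer hessKer)
open OneStepResolventKernel (Fib JetData)
open OneStepKernelFamily (TshotOf TbalOf D1Tel)
open HessianTelescopingKKT (wStep)
open Summit.QuantumFields.BalabanUV.Beta.SymSecondOrderTablesAn1 (symTablesAn1S2)
open Summit.QuantumFields.BalabanUV.Beta.CombChartJointEnd (JsB12CombShSym)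
open Summit.QuantumFields.BalabanUV.Beta.FP.StepRecursionFeed (d1Tel_anchored_of_kernel_laws_wStep)
open Summit.QuantumFields.BalabanUV.Beta.FP.StepRecursionFeedNested (fineId_of_transport_of_oneShotId)
open Summit.QuantumFields.BalabanUV.Beta.CompositeOneShotJetData (Roots Pins JcComp JcComp_one AN VN WN hN_JcComp)

variable {Lc : ℕ} [NeZero Lc] {FF FG : Type*} [Fintype FF] [Fintype FG]

/-- [folklore] **ROOT M‴'s `htel` AT THE RECORD PAIR, NESTED CURRENCY, `hN` BY NAME.**  With an2's N-system `(AN R j, VN R P j, WN R P j)` (F6d-2) and ANY F ∕ G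
systems: the kernel law per storey `j ≥ 1` (`hlaw`), the ANCHOR storey's fine identification (`hF₁`), the TRANSPORT clause per `j ≥ 1` (`htr`), the top-step
identification per `j ≥ 1` (`hG`) and (T0)(T1) — displayed — give `D1Tel Lc Js (JcComp hLc N cΛ cB R P)`; the one-shot identifications `hN (j ≥ 1)` are an2's
`hN_JcComp`, the anchor `hJc1` is `JcComp_one` (`rfl`). -/
theorem d1Tel_JcComp_nested_of_hessKer_laws_wStep (hLc : Odd Lc) (N : ℕ) (cΛ cB : ℝ) (R : Roots Lc) (P : Pins)
    (AF : ℕ → MKer 4 FF) (𝒱F : ℕ → Fin 4 → (Fin 4 → ℤ) → MKer 4 FF) (𝒲F : ℕ → Fin 4 → (Fin 4 → ℤ) → Fin 4 → (Fin 4 → ℤ) → MKer 4 FF)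
    (AG : ℕ → MKer 4 FG) (𝒱G : ℕ → Fin 4 → (Fin 4 → ℤ) → MKer 4 FG) (𝒲G : ℕ → Fin 4 → (Fin 4 → ℤ) → Fin 4 → (Fin 4 → ℤ) → MKer 4 FG)
    (hlaw : ∀ j : ℕ, 1 ≤ j → ∀ (μ ν : Fin 4) (z : Fin 4 → ℤ),
      hessKer (AN R j) (VN R P j) (WN R P j) μ ν z = hessKer (AF j) (𝒱F j) (𝒲F j) μ ν z + hessKer (AG j) (𝒱G j) (𝒲G j) μ ν z)
    (hF₁ : ∀ (μ ν : Fin 4) (z : Fin 4 → ℤ),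
      hessKer (AF 1) (𝒱F 1) (𝒲F 1) μ ν z
        = (Lc : ℝ) ^ 8 * dressedEntry (wStep Lc 1) (TshotOf Lc (JcComp hLc N cΛ cB R P) 1) ((Lc : ℤ) • z) μ ν)
    (htr : ∀ j : ℕ, 1 ≤ j → ∀ (μ ν : Fin 4) (z : Fin 4 → ℤ),
      hessKer (AF (j + 1)) (𝒱F (j + 1)) (𝒲F (j + 1)) μ ν z
        = (Lc : ℝ) ^ 8 * dressedEntry (wStep Lc (j + 1)) (hessKer (AN R j) (VN R P j) (WN R P j)) ((Lc : ℤ) • z) μ ν)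
    (hG : ∀ j : ℕ, 1 ≤ j → ∀ (μ ν : Fin 4) (z : Fin 4 → ℤ),
      hessKer (AG j) (𝒱G j) (𝒲G j) μ ν z = TbalOf Lc (JsB12CombShSym hLc N (symTablesAn1S2 3 Lc cΛ) cΛ cB) j μ ν z)
    (hT0 : ∀ j (c e : Fin 4), HasSum (TbalOf Lc (JsB12CombShSym hLc N (symTablesAn1S2 3 Lc cΛ) cΛ cB) j c e) 0)
    (hT1 : ∀ j (c e ρ : Fin 4), HasSum (fun t : Fin 4 → ℤ => t ρ • TbalOf Lc (JsB12CombShSym hLc N (symTablesAn1S2 3 Lc cΛ) cΛ cB) j c e t) 0) :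
    D1Tel Lc (JsB12CombShSym hLc N (symTablesAn1S2 3 Lc cΛ) cΛ cB) (JcComp hLc N cΛ cB R P) := by
  refine d1Tel_anchored_of_kernel_laws_wStep hLc N cΛ cB (JcComp hLc N cΛ cB R P) (JcComp_one hLc N cΛ cB R P)
    (fun j => hessKer (AN R j) (VN R P j) (WN R P j)) (fun j => hessKer (AF j) (𝒱F j) (𝒲F j)) (fun j => hessKer (AG j) (𝒱G j) (𝒲G j))
    hlaw (hN_JcComp hLc N cΛ cB R P) ?_ hG hT0 hT1
  intro j hj
  match j, hj with
  | 1, _ => exact hF₁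
  | j + 2, _ =>
    exact fineId_of_transport_of_oneShotId (𝒯 := TshotOf Lc (JcComp hLc N cΛ cB R P)) (w := wStep Lc)
      (fun j => hessKer (AN R j) (VN R P j) (WN R P j)) (fun j => hessKer (AF j) (𝒱F j) (𝒲F j)) (j + 1)
      (hN_JcComp hLc N cΛ cB R P (j + 1) (Nat.succ_pos j)) (htr (j + 1) (Nat.succ_pos j))

/-- [folklore] **THE (β1) TOWER's INSTANCE** — the same at the CENTRED roots `R := Roots.ctr Lc` (R-D1-g49-1 ∕ R-D1-g52-1; leaf-05 F6f `TowerRootCentred`). -/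
theorem d1Tel_JcComp_ctr_nested_of_hessKer_laws_wStep (hLc : Odd Lc) (N : ℕ) (cΛ cB : ℝ) (P : Pins)
    (AF : ℕ → MKer 4 FF) (𝒱F : ℕ → Fin 4 → (Fin 4 → ℤ) → MKer 4 FF) (𝒲F : ℕ → Fin 4 → (Fin 4 → ℤ) → Fin 4 → (Fin 4 → ℤ) → MKer 4 FF)
    (AG : ℕ → MKer 4 FG) (𝒱G : ℕ → Fin 4 → (Fin 4 → ℤ) → MKer 4 FG) (𝒲G : ℕ → Fin 4 → (Fin 4 → ℤ) → Fin 4 → (Fin 4 → ℤ) → MKer 4 FG)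
    (hlaw : ∀ j : ℕ, 1 ≤ j → ∀ (μ ν : Fin 4) (z : Fin 4 → ℤ),
      hessKer (AN (Roots.ctr Lc) j) (VN (Roots.ctr Lc) P j) (WN (Roots.ctr Lc) P j) μ ν z
        = hessKer (AF j) (𝒱F j) (𝒲F j) μ ν z + hessKer (AG j) (𝒱G j) (𝒲G j) μ ν z)
    (hF₁ : ∀ (μ ν : Fin 4) (z : Fin 4 → ℤ),
      hessKer (AF 1) (𝒱F 1) (𝒲F 1) μ ν z
        = (Lc : ℝ) ^ 8 * dressedEntry (wStep Lc 1) (TshotOf Lc (JcComp hLc N cΛ cB (Roots.ctr Lc) P) 1) ((Lc : ℤ) • z) μ ν)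
    (htr : ∀ j : ℕ, 1 ≤ j → ∀ (μ ν : Fin 4) (z : Fin 4 → ℤ),
      hessKer (AF (j + 1)) (𝒱F (j + 1)) (𝒲F (j + 1)) μ ν z
        = (Lc : ℝ) ^ 8 * dressedEntry (wStep Lc (j + 1))
            (hessKer (AN (Roots.ctr Lc) j) (VN (Roots.ctr Lc) P j) (WN (Roots.ctr Lc) P j)) ((Lc : ℤ) • z) μ ν)
    (hG : ∀ j : ℕ, 1 ≤ j → ∀ (μ ν : Fin 4) (z : Fin 4 → ℤ),
      hessKer (AG j) (𝒱G j) (𝒲G j) μ ν z = TbalOf Lc (JsB12CombShSym hLc N (symTablesAn1S2 3 Lc cΛ) cΛ cB) j μ ν z)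
    (hT0 : ∀ j (c e : Fin 4), HasSum (TbalOf Lc (JsB12CombShSym hLc N (symTablesAn1S2 3 Lc cΛ) cΛ cB) j c e) 0)
    (hT1 : ∀ j (c e ρ : Fin 4), HasSum (fun t : Fin 4 → ℤ => t ρ • TbalOf Lc (JsB12CombShSym hLc N (symTablesAn1S2 3 Lc cΛ) cΛ cB) j c e t) 0) :
    D1Tel Lc (JsB12CombShSym hLc N (symTablesAn1S2 3 Lc cΛ) cΛ cB) (JcComp hLc N cΛ cB (Roots.ctr Lc) P) :=
  d1Tel_JcComp_nested_of_hessKer_laws_wStep hLc N cΛ cB (Roots.ctr Lc) P AF 𝒱F 𝒲F AG 𝒱G 𝒲G hlaw hF₁ htr hG hT0 hT1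

end Summit.QuantumFields.BalabanUV.Beta.FP.StepRecursionFeedNestedComp

end
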